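import Literature.MathematicalPhysics.QuantumFieldTheory.Balaban1983to89.B9SectBH1FrameCodedY
import Literature.MathematicalPhysics.QuantumFieldTheory.Balaban1983to89.Node00.OpsYGauge

/-!
# `Balaban1983to89.B9Eq340HolderLipParSymY` — ★★ THE TRANSPORTER LAW `HolderLipY` DISCHARGED for def-Y's record transporter `parSymY`: covariant Lipschitz
# INSIDE A BLOCK, `‖R(U(Γ_{z,z′}))Ψ(z′) − Ψ(z)‖ ≦ (d+1)·η⁻¹·(η|z′−z|_T)·sup_{w ∈ Δ, μ}‖(∇_{U,μ}Ψ)(w)‖` for `z, z′` in one block `Δ` and unitary-type `U`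
# (pub-ymgap N06 row 13: removes the one displayed law of the (3.43) member `B9SectBH1FrameCodedY.stepH1Pos_KSCU_on` at the record)

T. Bałaban, *Propagators for lattice gauge theories in a background field*, Commun. Math. Phys. **99** (1985) 389–434
[`Balaban1985BackgroundPropagators`, "B9"]; [4] = T. Bałaban, *Propagators and renormalization transformations for lattice gauge
theories. II*, Commun. Math. Phys. **96** (1984) 223–250 [`Balaban1984PropagatorsII`].

statement-level skeleton of published theorems with citation tags; proofs where landed; nothing here is a claim about the
Yang–Mills mass gap

THE PRINTED LOCI.  (3.40) p. 397: the covariant Hölder quotient with `U(Γ_{x,x′})`, `Γ_{x,x′}` *"a shortest contour"* between `x` and `x′`; (3.3) p. 390 (the covariant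
difference); the mean-value step behind every Hölder estimate of Sect. B (p. 403: *"the same inequalities hold for G′(U′U)"*); [4] (2.1) p. 224 (blocks `B^j(y)`
of side `Lʲη`).

WHY THIS FILE (seat dag-n06-c gen 12).  The letters-level (3.43) frame instance `B9SectBH1FrameCodedY.h1Frame₃CodedOn` displays ONE law on the transporter of the
Hölder quotients, `B9SectBH1ProbesY.HolderLipY c_Lip (par U) U` (used for r06's undifferentiated premise (a′)).  For the record's transporter
`Node00.parSymY` (axis-ordered taxicab contours, symmetrised by `toLex`) the law HOLDS with `c_Lip = d + 1` at every configuration with unitary-type bond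
variables: the tree already has the telescoping of the transported difference along def-Y's contour (`B9Eq340CovariantLipschitzY.norm_R_parSY_sub_le` ∕
`norm_R_inv_parSY_sub_le`, n06-w6's `B9Eq340TaxiTelescope`), the length bound `|Γ_{z,z′}| ≦ (d+1)·η⁻¹·(η|z′−z|_T)` (`length_taxiSteps_le_mul_pdist`), and n06-w5's
RUNG LOCALITY `B9Eq358TaxiLettersY.blkOf_toBox_rung_eq` (every rung of the contour between two sites of a block lies in the block — the shorter arcs stay in the
cube).  THIS FILE assembles them: §1 `pdist_comm`, the chart identity `covD_comp_boxEquiv` (def-Y's `∇_{U,μ}` IS the torus-level `covD`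
through `boxEquiv`, from `Node00.OpsYGauge.boxEquiv_symm_shiftY`), `rung_bound` (the rung-wise bound by the block sup); §2 ★★ `holderLipY_parSymY` and its
`G`-valued ∕ (3.35)-regular corollaries `holderLipY_parSymY_of_gVal`, ★★ `hLip_parSymY` (exactly the binder `hLip` of `stepH1Pos_KSCU_on` at `par j := parSymY`,
`cLip := d + 1`); §3 ★★ `stepH1Pos_KSCU_parSymY_on` — `B9SectBH1FrameCodedY.stepH1Pos_KSCU_on` at `par j := parSymY` with the law
discharged: the (3.43) member of `SectBStepU` at the record's transporter with NO displayed law beyond the root frame's data.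
HONEST SCOPE.  Bookkeeping over landed lemmas; nothing of [B9] asserted; COUNT-NEUTRAL; N06 NOT discharged; one finite lattice programme at fixed ε —
nothing continuum, nothing about OS positivity or the mass gap.
-/

noncomputable section

namespace Literature.MathematicalPhysics.QuantumFieldTheory.Balaban1983to89.B9Eq340HolderLipParSymY

open T4RelativeLadder (UnitaryLike)
open B9BackgroundsKLevelV1 (shiftsV1)
open B9Eq39Adjoint (R covD)
open B9Eq340StepLasso (rungSites taxiSteps)
open B4TorusKernel.MultiPeriod (torusSupNorm)
open B6GlobalChartV1 (boxEquiv boxEquiv_apply PV)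
open B6Geom246MultiLevelBox (blkOf)
open B6Geom246MultiLevelTorus (torusSupNorm_neg)
open B6KLevelCensusIndexV1 (KIdx)
open B6Ineq2142KLevelV1 (β)
open B6Prop22KLevelTorusCensusEta (nKT nKT_pos)
open B9Eq340CovariantLipschitzY (norm_R_parSY_sub_le norm_R_inv_parSY_sub_le length_taxiSteps_le_mul_pdist)
open B9Eq358TaxiLettersY (blkOf_toBox_rung_eq val_sub_corner)
open B9Eq360DeltaPrimeAY (blkY)
open B9PinMembersKLevelV1 (MemberY geo9Y bg9Y)
open B9SectBGpLettersY (GVal norm_le_one_and_inv_of_mem)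
open B9SectBH1ProbesY (HolderLipY)
open Node00 (SiteY BlkY CfgY UboxY shiftY etaS cdS supBlkS' parSY parSymY parSymY_of_le parSymY_of_not_le toKT boxEquiv_symm_shiftY)
open Node00.OpsYHolderFar (pdist pdist_nonneg one_le_NB)
open Node00.OpsYRead342 (norm_le_supBlkS')

variable {d ℓ : ℕ} {hd : 1 ≤ d + 1} {hL : Odd (ℓ + 1) ∧ 1 < ℓ + 1} {b₀ b₁ : ℝ}
variable {𝔸 : Type} [NormedRing 𝔸] [NormedAlgebra ℂ 𝔸] [CompleteSpace 𝔸]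
variable (i : KIdx d ℓ hd hL b₀ b₁)

/-! ## §1 Tools -/

omit [NormedRing 𝔸] [NormedAlgebra ℂ 𝔸] [CompleteSpace 𝔸] in
/-- print's physical torus distance is symmetric. [cite: Balaban1985BackgroundPropagators, (3.40) p.397, bookkeeping] -/
theorem pdist_comm (z z' : SiteY i) : pdist i z z' = pdist i z' z := by
  unfold pdist
  rw [← torusSupNorm_neg (one_le_NB i) (z'.1 - z.1), neg_sub]

/-- ★ def-Y's `∇_{U,μ}` on the box chart IS the torus-level `covD` read through `boxEquiv`: `(covD U μ (Ψ ∘ boxEquiv))(x) = (∇_{U,μ}Ψ)(boxEquiv x)`.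
[cite: Balaban1985BackgroundPropagators, (3.3) pp.390–391; Balaban1984PropagatorsII, (2.1) p.224 (the chart)] -/
theorem covD_comp_boxEquiv (U : CfgY 𝔸 i) (μ : Fin (d + 1)) (Ψ : SiteY i → 𝔸) (x : Site (PV d ℓ i.m i.K hd hL) 0) :
    covD (shiftsV1 (PV d ℓ i.m i.K hd hL)) U μ (fun y => Ψ (boxEquiv i.hN y)) x = cdS i U μ Ψ (boxEquiv i.hN x) := by
  have hsh : boxEquiv i.hN (shiftsV1 (PV d ℓ i.m i.K hd hL) μ x) = shiftY i μ (boxEquiv i.hN x) := by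
    apply (boxEquiv i.hN).symm.injective
    rw [Equiv.symm_apply_apply, boxEquiv_symm_shiftY, Equiv.symm_apply_apply]
    rfl
  show R (U μ x) (Ψ (boxEquiv i.hN (shiftsV1 (PV d ℓ i.m i.K hd hL) μ x))) - Ψ (boxEquiv i.hN x) =
    R (U μ ((boxEquiv i.hN).symm (boxEquiv i.hN x))) (Ψ (shiftY i μ (boxEquiv i.hN x))) - Ψ (boxEquiv i.hN x)
  rw [Equiv.symm_apply_apply, hsh]

/-- ★ **THE RUNG-WISE BOUND INSIDE A BLOCK**: for `z, z′` in the block `s`, every rung of def-Y's contour from `z` to `z′` lies in `s`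
(`B9Eq358TaxiLettersY.blkOf_toBox_rung_eq`), so its covariant difference is bounded by the block sup `sup_{w ∈ Δ(s), μ}‖(∇_{U,μ}Ψ)(w)‖`.
[cite: Balaban1985BackgroundPropagators, (3.40) p.397 («a shortest contour»), (3.3) p.390; Balaban1984PropagatorsII, (2.1) p.224] -/
theorem rung_bound (U : CfgY 𝔸 i) (Ψ : SiteY i → 𝔸) (s : BlkY i) {z z' : SiteY i} (hz : blkY i z = s) (hz' : blkY i z' = s) :
    ∀ r ∈ rungSites (taxiSteps (List.finRange (d + 1)) ((boxEquiv i.hN).symm z) ((boxEquiv i.hN).symm z')) ((boxEquiv i.hN).symm z),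
      ‖covD (shiftsV1 _) U r.2.1 (fun x => Ψ (boxEquiv i.hN x)) r.1‖ ≤ supBlkS' i s (fun μ => cdS i U μ Ψ) := by
  intro r hr
  have hblk : blkOf i.D.toDomains (B6GlobalChartV1.toBox i.hN r.1) = s :=
    blkOf_toBox_rung_eq i s _ _ (fun μ => (val_sub_corner i s hz μ).2) (fun μ => (val_sub_corner i s hz' μ).2) r hr
  rw [covD_comp_boxEquiv]
  exact norm_le_supBlkS' i s (fun μ => cdS i U μ Ψ) r.2.1 (by rw [boxEquiv_apply]; exact hblk)

/-! ## §2 The law for `parSymY` -/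

/-- ★★ **`HolderLipY (d+1) (parSymY U) U` AT EVERY CONFIGURATION WITH UNITARY-TYPE BOND VARIABLES**: for `z, z′` in one block `Δ(s)`,
`‖R(parSymY U z z′)Ψ(z′) − Ψ(z)‖ ≦ (d+1)·η⁻¹·(η|z′−z|_T)·sup_{w ∈ Δ(s), μ}‖(∇_{U,μ}Ψ)(w)‖` — the transported difference telescopes along def-Y's taxicab contour
(either orientation), whose rungs stay in the block and whose length is `≦ (d+1)·|z′−z|_T`.
[cite: Balaban1985BackgroundPropagators, (3.40) p.397, (3.3) p.390, p.403; Balaban1984PropagatorsII, (2.1) p.224] -/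
theorem holderLipY_parSymY [NormOneClass 𝔸] {U : CfgY 𝔸 i} (hU : ∀ μ x, UnitaryLike (U μ x)) : HolderLipY i ((d : ℝ) + 1) (parSymY i U) U := by
  intro Ψ s z z' hz hz'
  set G : ℝ := supBlkS' i s (fun μ => cdS i U μ Ψ) with hG
  have hG0 : 0 ≤ G := B9Ineq349SiteReading.supBlkS'_nonneg i s _
  have hn : 0 < (((nKT (toKT i) : ℕ) : ℝ)) := nKT_pos (toKT i)
  have hη : (etaS i)⁻¹ = (((nKT (toKT i) : ℕ) : ℝ)) := by
    show (((((nKT (toKT i) : ℕ) : ℝ)))⁻¹)⁻¹ = _; rw [inv_inv]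
  rw [hη]
  by_cases hle : toLex z.1 ≤ toLex z'.1
  · rw [parSymY_of_le hle]
    refine (norm_R_parSY_sub_le i hU Ψ z z' (rung_bound i U Ψ s hz hz')).trans ?_
    have hlen := length_taxiSteps_le_mul_pdist i z z'
    calc ((taxiSteps (List.finRange (d + 1)) ((boxEquiv i.hN).symm z) ((boxEquiv i.hN).symm z')).length : ℝ) * G
        ≤ (((d : ℝ) + 1) * ((((nKT (toKT i) : ℕ) : ℝ)) * pdist i z z')) * G := mul_le_mul_of_nonneg_right hlen hG0
      _ = ((d : ℝ) + 1) * (((nKT (toKT i) : ℕ) : ℝ)) * pdist i z z' * G := by ring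
  · rw [parSymY_of_not_le hle]
    refine (norm_R_inv_parSY_sub_le i hU Ψ z z' (rung_bound i U Ψ s hz' hz)).trans ?_
    have hlen := length_taxiSteps_le_mul_pdist i z' z
    rw [pdist_comm i z' z] at hlen
    calc ((taxiSteps (List.finRange (d + 1)) ((boxEquiv i.hN).symm z') ((boxEquiv i.hN).symm z)).length : ℝ) * G
        ≤ (((d : ℝ) + 1) * ((((nKT (toKT i) : ℕ) : ℝ)) * pdist i z z')) * G := mul_le_mul_of_nonneg_right hlen hG0
      _ = ((d : ℝ) + 1) * (((nKT (toKT i) : ℕ) : ℝ)) * pdist i z z' * G := by ring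

/-- ★ the law at a `G`-valued configuration (`G ≤ U(𝔸)` with unit norms). [cite: Balaban1985BackgroundPropagators, (3.40) p.397, (3.35) p.396] -/
theorem holderLipY_parSymY_of_gVal [NormOneClass 𝔸] (G : Subgroup 𝔸ˣ) (hG1 : ∀ u : 𝔸ˣ, u ∈ G → ‖(u : 𝔸)‖ ≤ 1) {U : CfgY 𝔸 i}
    (hU : GVal G i U) : HolderLipY i ((d : ℝ) + 1) (parSymY i U) U :=
  holderLipY_parSymY i fun μ x => norm_le_one_and_inv_of_mem G hG1 (hU μ x)

/-- ★★ **THE BINDER `hLip` OF `B9SectBH1FrameCodedY.stepH1Pos_KSCU_on` AT THE RECORD's TRANSPORTER**: for a subfamily `f` with `par j := parSymY`, at every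
(3.35)-regular configuration of the member (hence `G`-valued) the law holds with `c_Lip = d + 1`.
[cite: Balaban1985BackgroundPropagators, (3.40) p.397, (3.35) p.396, Thm 3.4 p.400] -/
theorem hLip_parSymY [NormOneClass 𝔸] {Mstar : ℕ} {J : Type} (f : J → MemberY d ℓ hd hL b₀ b₁ Mstar) (c35 : ℝ) (G : Subgroup 𝔸ˣ)
    (hG1 : ∀ u : 𝔸ˣ, u ∈ G → ‖(u : 𝔸)‖ ≤ 1) :
    ∀ (j : J) (α₀ : ℝ) (U : CfgY 𝔸 (f j).toKIdx), (bg9Y 𝔸 G (f j)).Reg335 c35 α₀ U →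
      HolderLipY (f j).toKIdx ((d : ℝ) + 1) (parSymY (f j).toKIdx U) U :=
  fun j _ _ hreg => holderLipY_parSymY_of_gVal (f j).toKIdx G hG1 hreg.1.1

/-! ## §3 The (3.43) block-step of `KSCU` at the record's transporter, law-free -/

section Step

open B9SectBCodedCarrier (pullS)
open B9Eq360DeltaPrimeAY (AfldY)
open B9SectBGpFrameCodedY (codingYx CplxLettersY)
open B9SectBCodedReadingsU (KSCU KACU)
open B9SectBStepWhole (StepH1Pos)
open B9SectBH1FrameCodedY (stepH1Pos_KSCU_on)
open Node00 (IBondY SiteParY BondParY BondOpY deltaPrimeAY)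

variable [NormOneClass 𝔸] [FiniteDimensional ℝ 𝔸] {Mstar : ℕ} {J : Type} (f : J → MemberY d ℓ hd hL b₀ b₁ Mstar)
  [∀ x : MemberY d ℓ hd hL b₀ b₁ Mstar, Fintype (geo9Y x).Site]
  [instDS : ∀ x : MemberY d ℓ hd hL b₀ b₁ Mstar, DecidableEq (geo9Y x).Site] [instNE : ∀ x : MemberY d ℓ hd hL b₀ b₁ Mstar, Nonempty (geo9Y x).Site]
  (c35 : ℝ) (G : Subgroup 𝔸ˣ) (OA : ∀ j : J, BondOpY 𝔸 (f j).toKIdx)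
  (parB : ∀ j : J, BondParY 𝔸 (f j).toKIdx) {ι : Type} [Fintype ι] [DecidableEq ι] (b : Module.Basis ι ℝ 𝔸)
  (ιB : ∀ j : J, BlkY (f j).toKIdx → IBondY (f j).toKIdx)
  (C37 C38 : ∀ j : J, ℝ → CfgY 𝔸 (f j).toKIdx → AfldY 𝔸 (f j).toKIdx → Prop)
  (Cinv : ∀ j : J, B9.SiteKernel (geo9Y (f j)) (bg9Y 𝔸 G (f j)))

/-- ★★ **`StepH1Pos` OF `KSCU` AT THE RECORD's TRANSPORTER `parSymY`, LAW-FREE**: `B9SectBH1FrameCodedY.stepH1Pos_KSCU_on` with `par j := parSymY`, `c_Lip := d+1`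
and `hLip := hLip_parSymY` — the (3.43) member of `B9SectBCodedReadingsU.SectBStepU` (G′ side) with exactly the binders of `B9SectBStepsKSCUBlocks.stepEPos_KSCU_on`.
[cite: Balaban1985BackgroundPropagators, Thm 3.4 p.400, Thm 3.1 (3.43) p.398, (3.40) p.397, p.403 l.1–9, (3.35)–(3.37) p.396; Balaban1984PropagatorsII, Lemma 2.1 p.234, (2.51)–(2.52) p.232] -/
theorem stepH1Pos_KSCU_parSymY_on (hι : ∀ (j : J) (s : BlkY (f j).toKIdx), β (f j).toKIdx.hN (f j).toKIdx.D (f j).toKIdx.hk (ιB j s) = s)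
    (hG1 : ∀ u : 𝔸ˣ, u ∈ G → ‖(u : 𝔸)‖ ≤ 1)
    (hpar : ∀ j (U : CfgY 𝔸 (f j).toKIdx), GVal G (f j).toKIdx U → ∀ z w, parSymY (f j).toKIdx U z w ∈ G)
    (hunit : ∀ j (U : CfgY 𝔸 (f j).toKIdx), GVal G (f j).toKIdx U → IsUnit (deltaPrimeAY (f j).toKIdx (parSymY (f j).toKIdx) U))
    (dB : ℕ) (M₂ : ℝ) (hM₂ : 0 ≤ M₂) (hrepr : ∀ (v : 𝔸) (j : ι), |b.repr v j| ≤ M₂ * ‖v‖) (hcR : 0 < M₂ * ∑ j, ‖b j‖)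
    (Cq : ℝ) (hCq : 0 ≤ Cq)
    (hC37 : ∀ j β' U a, C37 j β' U a → GVal G (f j).toKIdx U ∧ CplxLettersY G (f j) (parSymY (f j).toKIdx) (ιB j) Cq β' U a)
    (MInv aInv aW : ℝ) (hMInv : 0 < MInv) (haInv : 0 < aInv) (haW : 0 < aW) :
    StepH1Pos dB c35 (fun j => geo9Y (f j)) (fun j => (codingYx G (f j) (C37 j) (C38 j)).bg)
      (fun j => KSCU G (f j) (parSymY (f j).toKIdx) (C37 j) (C38 j)) (fun j => KACU G (f j) (OA j) (parB j) (C37 j) (C38 j))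
      (fun j => pullS (codingYx G (f j) (C37 j) (C38 j)) (Cinv j)) (fun j => KSCU G (f j) (parSymY (f j).toKIdx) (C37 j) (C38 j)) :=
  stepH1Pos_KSCU_on f c35 G (fun j => parSymY (f j).toKIdx) OA parB b ιB C37 C38 Cinv hι hG1 hpar hunit dB M₂ hM₂ hrepr hcR Cq hCq hC37
    MInv aInv aW hMInv haInv haW (by positivity : (0 : ℝ) ≤ (d : ℝ) + 1) (hLip_parSymY f c35 G hG1)

end Step

end Literature.MathematicalPhysics.QuantumFieldTheory.Balaban1983to89.B9Eq340HolderLipParSymY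

end
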